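import Mathlib.Analysis.MellinInversion
import Mathlib.Analysis.SpecialFunctions.Integrals.Basic
import Mathlib.Analysis.SpecialFunctions.Integrability.Basic
import Mathlib.MeasureTheory.Integral.IntegralEqImproper
import Mathlib.NumberTheory.LSeries.Basic
import HarnessLib

/-!
# Hoffstein's smoothing kernel `x^s/(s(s+2)(s+3)(s+4)(s+5)(s+6))` and its smoothed Perron formula

Topic `Literature/NumberTheory/LFunctions`. Everything in this file is PROVED (no named fact, no
sorry). This is the Mellin-analysis section of the discharge of the tree's named fact
`Literature.NumberTheory.LFunctions.hoffstein1980_lemma1` (`SiegelTatuzawaExplicit.lean`):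
J. Hoffstein, *On the Siegel–Tatuzawa theorem*, Acta Arith. **38** (1980) 167–174, Lemma 1,
proof, p. 168: "by the standard argument ([2], p. 31)
`(1/2πi) ∫_{2−i∞}^{2+i∞} x^s ds/(s ∏_{n=2}^{6}(s+n)) = 1/6! − Σ_{n=2}^{6} (n−1)(−1)^n/(n!(6−n)! x^n) > 0`
if `x > 1`, `0` if `0 < x < 1`", and p. 169: "Since for `Re s > 1`, `ζ_k(s) = Σ (N𝔞)^{-s}`, it
follows that `I = (1/2πi)∫ ζ_k(s+β) x^s ds/(s∏(s+n)) = Σ_{N𝔞 ≤ x} (N𝔞)^{-β}(1/6! − Σ …)`".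

We package the weight as a function on `(0, ∞)` and obtain the identity by Mellin inversion
(Mathlib's `mellinInv_mellin_eq`) rather than by the residue computation of [2] = Davenport:

* `hoffPoly u = 1 − 15u² + 40u³ − 45u⁴ + 24u⁵ − 5u⁶ = (1 − u)⁵ (1 + 5u)` — `6!` times Hoffstein's
  weight at `u = n/x ≤ 1` (`hoffPoly_eq`, `hoffPoly_nonneg`, and the lower bound
  `1 − 15u² ≤ hoffPoly u` on `[0,1]` used in Hoffstein's (2), `one_sub_le_hoffPoly`);
* `hoffWeight u = hoffPoly u / 720` for `u ≤ 1` and `0` for `u > 1` (continuous, `hoffPoly 1 = 0`);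
* `hoffKernel s = 1/(s(s+2)(s+3)(s+4)(s+5)(s+6))`, and **`mellin_hoffWeight`**: for `0 < Re s`,
  `mellin hoffWeight s = hoffKernel s` (partial fractions
  `720 · hoffKernel s = 1/s − 15/(s+2) + 40/(s+3) − 45/(s+4) + 24/(s+5) − 5/(s+6)`);
* `norm_hoffKernel_le_of_pos`, `integrable_hoffKernel_vertical` — on a line `Re s = c > 0`,
  `‖hoffKernel (c+iy)‖ ≤ 1/(c⁴ (c² + y²))`, so the kernel is absolutely integrable;
* **`integral_LSeries_mul_hoffKernel_eq`** — the smoothed Perron formula: for an `L`-series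
  `f(z) = Σ a(n) n^{-z}` absolutely convergent at `Re z = Re s + c` (`c > 0`) and `x > 0`,
  `∫ f(s + c + iy) x^{c+iy} hoffKernel(c+iy) dy = 2π Σ_n a(n) n^{-s} hoffWeight(n/x)`
  (termwise Mellin inversion; the interchange of sum and integral by absolute convergence).

## References

* J. Hoffstein, On the Siegel–Tatuzawa theorem, Acta Arith. 38 (1980) 167–174, §2, proof of
  Lemma 1, pp. 168–169. [Hoffstein1980SiegelTatuzawa]
* H. Davenport, *Multiplicative Number Theory*, 2nd ed., GTM 74, p. 31 (Hoffstein's [2]) and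
  H. L. Montgomery, R. C. Vaughan, *Multiplicative Number Theory I*, §5.1 (Mellin–Perron kernels).
  [MontgomeryVaughan2007]
-/

noncomputable section

open Complex Set MeasureTheory Filter Topology intervalIntegral

namespace Literature.NumberTheory.LFunctions.Hoffstein1980

/-! ### The polynomial weight -/

/-- `6!` times Hoffstein's weight: `P(u) = 1 − 15u² + 40u³ − 45u⁴ + 24u⁵ − 5u⁶`
(`= 1 − 6! Σ_{n=2}^{6} (n−1)(−1)^n u^n/(n!(6−n)!)`). [cite: Hoffstein1980SiegelTatuzawa, §2 p. 168] -/
def hoffPoly (u : ℝ) : ℝ := 1 - 15 * u ^ 2 + 40 * u ^ 3 - 45 * u ^ 4 + 24 * u ^ 5 - 5 * u ^ 6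

/-- The factorisation `P(u) = (1 − u)⁵ (1 + 5u)` of Hoffstein's weight polynomial. [cite: Hoffstein1980SiegelTatuzawa, §2 proof of Lemma 1 p. 168] -/
theorem hoffPoly_eq (u : ℝ) : hoffPoly u = (1 - u) ^ 5 * (1 + 5 * u) := by
  unfold hoffPoly; ring

/-- `P(1) = 0` (the weight vanishes at `u = n/x = 1`). [cite: Hoffstein1980SiegelTatuzawa, §2 proof of Lemma 1 p. 168] -/
theorem hoffPoly_one : hoffPoly 1 = 0 := by rw [hoffPoly_eq]; norm_num

/-- `P(0) = 1`. [cite: Hoffstein1980SiegelTatuzawa, §2 proof of Lemma 1 p. 168] -/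
theorem hoffPoly_zero : hoffPoly 0 = 1 := by norm_num [hoffPoly]

/-- `P(u) ≥ 0` for `0 ≤ u ≤ 1` ("every term of the right-hand side is `> 0`", p. 169). [cite: Hoffstein1980SiegelTatuzawa, §2 proof of Lemma 1 p. 169] -/
theorem hoffPoly_nonneg {u : ℝ} (h0 : 0 ≤ u) (h1 : u ≤ 1) : 0 ≤ hoffPoly u := by
  rw [hoffPoly_eq]
  exact mul_nonneg (pow_nonneg (by linarith) 5) (by linarith)

/-- **Hoffstein's (2), the pointwise input**: `1 − 15u² ≤ P(u)` for `0 ≤ u ≤ 1`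
(indeed `P(u) − (1 − 15u²) = u³(40 − 45u + 24u² − 5u³) ≥ 0`).
[cite: Hoffstein1980SiegelTatuzawa, §2 (2) p. 169] -/
theorem one_sub_le_hoffPoly {u : ℝ} (h0 : 0 ≤ u) (h1 : u ≤ 1) : 1 - 15 * u ^ 2 ≤ hoffPoly u := by
  have h3 : 0 ≤ u ^ 3 := pow_nonneg h0 3
  have hq : 0 ≤ 40 - 45 * u + 24 * u ^ 2 - 5 * u ^ 3 := by nlinarith [mul_nonneg h0 (sub_nonneg.2 h1)]
  have : hoffPoly u - (1 - 15 * u ^ 2) = u ^ 3 * (40 - 45 * u + 24 * u ^ 2 - 5 * u ^ 3) := by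
    unfold hoffPoly; ring
  nlinarith [mul_nonneg h3 hq]

/-- `P(u) ≤ 6` on `[0,1]`. [cite: Hoffstein1980SiegelTatuzawa, §2 proof of Lemma 1 p. 168] -/
theorem hoffPoly_le_six {u : ℝ} (h0 : 0 ≤ u) (h1 : u ≤ 1) : hoffPoly u ≤ 6 := by
  rw [hoffPoly_eq]
  have h5 : (1 - u) ^ 5 ≤ 1 := pow_le_one₀ (by linarith) (by linarith)
  nlinarith [pow_nonneg (sub_nonneg.2 h1) 5]

/-- Hoffstein's weight as a function on `(0, ∞)`: `w(u) = P(u)/720` for `u ≤ 1`, `0` for `u > 1`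
(complex-valued, for Mellin analysis). [cite: Hoffstein1980SiegelTatuzawa, §2 p. 168] -/
def hoffWeight (u : ℝ) : ℂ := if u ≤ 1 then ((hoffPoly u / 720 : ℝ) : ℂ) else 0

/-- `w(u) = P(u)/720` for `u ≤ 1`. [cite: Hoffstein1980SiegelTatuzawa, §2 proof of Lemma 1 p. 168] -/
theorem hoffWeight_of_le_one {u : ℝ} (hu : u ≤ 1) : hoffWeight u = ((hoffPoly u / 720 : ℝ) : ℂ) := by
  simp [hoffWeight, hu]

/-- `w(u) = 0` for `u > 1`. [cite: Hoffstein1980SiegelTatuzawa, §2 proof of Lemma 1 p. 168] -/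
theorem hoffWeight_of_one_lt {u : ℝ} (hu : 1 < u) : hoffWeight u = 0 := by
  simp [hoffWeight, not_le.2 hu]

/-- The weight is real and non-negative on `[0, ∞)`. [cite: Hoffstein1980SiegelTatuzawa, §2 proof of Lemma 1 p. 169] -/
theorem hoffWeight_re_nonneg {u : ℝ} (h0 : 0 ≤ u) : 0 ≤ (hoffWeight u).re := by
  rcases le_or_gt u 1 with h | h
  · rw [hoffWeight_of_le_one h, ofReal_re]; exact div_nonneg (hoffPoly_nonneg h0 h) (by norm_num)
  · rw [hoffWeight_of_one_lt h]; simp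

/-- The weight is real. [cite: Hoffstein1980SiegelTatuzawa, §2 proof of Lemma 1 p. 168] -/
theorem hoffWeight_im (u : ℝ) : (hoffWeight u).im = 0 := by
  rcases le_or_gt u 1 with h | h
  · rw [hoffWeight_of_le_one h, ofReal_im]
  · rw [hoffWeight_of_one_lt h]; simp

/-- `‖w(u)‖ ≤ 1/120` for `u ≥ 0`. [cite: Hoffstein1980SiegelTatuzawa, §2 proof of Lemma 1 p. 168] -/
theorem norm_hoffWeight_le {u : ℝ} (h0 : 0 ≤ u) : ‖hoffWeight u‖ ≤ 1 / 120 := by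
  rcases le_or_gt u 1 with h | h
  · rw [hoffWeight_of_le_one h, Complex.norm_real, Real.norm_of_nonneg
      (div_nonneg (hoffPoly_nonneg h0 h) (by norm_num))]
    have := hoffPoly_le_six h0 h
    linarith [show hoffPoly u / 720 ≤ 6 / 720 from by gcongr]
  · rw [hoffWeight_of_one_lt h]; simp

/-- The weight is continuous (the two pieces agree at `u = 1` since `P(1) = 0`). [cite: Hoffstein1980SiegelTatuzawa, §2 proof of Lemma 1 p. 168] -/
theorem continuous_hoffWeight : Continuous hoffWeight := by
  have h1 : Continuous fun u : ℝ ↦ ((hoffPoly u / 720 : ℝ) : ℂ) := by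
    refine continuous_ofReal.comp ?_
    unfold hoffPoly
    fun_prop
  have h : Continuous fun u : ℝ ↦ if u ≤ 1 then ((hoffPoly u / 720 : ℝ) : ℂ) else 0 :=
    h1.if_le continuous_const continuous_id continuous_const (fun x hx ↦ by
      rw [hx, hoffPoly_one]; simp)
  exact h

/-! ### The kernel and the Mellin transform of the weight -/

/-- Hoffstein's kernel `K(s) = 1/(s(s+2)(s+3)(s+4)(s+5)(s+6))` (no factor `s+1`).
[cite: Hoffstein1980SiegelTatuzawa, §2 (1) p. 168] -/
def hoffKernel (s : ℂ) : ℂ := 1 / (s * (s + 2) * (s + 3) * (s + 4) * (s + 5) * (s + 6))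

/-- Partial fractions: `720 K(s) = 1/s − 15/(s+2) + 40/(s+3) − 45/(s+4) + 24/(s+5) − 5/(s+6)` away
from the poles (the residues `(n−1)(−1)^n 6!/(n!(6−n)!)` of Hoffstein's display, p. 168). [cite: Hoffstein1980SiegelTatuzawa, §2 proof of Lemma 1 p. 168] -/
theorem hoffKernel_eq_partialFractions {s : ℂ} (h0 : s ≠ 0) (h2 : s + 2 ≠ 0) (h3 : s + 3 ≠ 0)
    (h4 : s + 4 ≠ 0) (h5 : s + 5 ≠ 0) (h6 : s + 6 ≠ 0) :
    hoffKernel s = (1 / s - 15 / (s + 2) + 40 / (s + 3) - 45 / (s + 4) + 24 / (s + 5)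
      - 5 / (s + 6)) / 720 := by
  unfold hoffKernel
  field_simp
  ring

/-- `∫₀¹ t^{s-1} t^j dt = 1/(s+j)` for `Re s > 0`. [folklore] -/
private theorem integral_cpow_mul_pow {s : ℂ} (hs : 0 < s.re) (j : ℕ) :
    ∫ t in (0:ℝ)..1, (t : ℂ) ^ (s - 1) * (t : ℂ) ^ j = 1 / (s + j) := by
  have hr : -1 < (s - 1 + j).re := by simp; linarith [(j.cast_nonneg : (0:ℝ) ≤ j)]
  have hne : s + j ≠ 0 := fun h' ↦ by
    have := congrArg Complex.re h'; simp at this; linarith [(j.cast_nonneg : (0:ℝ) ≤ j)]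
  have heq : ∀ t ∈ Set.uIcc (0:ℝ) 1, (t : ℂ) ^ (s - 1) * (t : ℂ) ^ j = (t : ℂ) ^ (s - 1 + j) := by
    intro t ht
    rw [Set.uIcc_of_le zero_le_one] at ht
    rcases ht.1.eq_or_lt with h | h
    · rw [← h]
      rcases Nat.eq_zero_or_pos j with hj | hj
      · subst hj; simp
      · have h2 : s - 1 + j ≠ 0 := fun h' ↦ by
          have := congrArg Complex.re h'; simp at this
          have hj1 : (1:ℝ) ≤ j := by exact_mod_cast hj
          linarith
        simp [Complex.zero_cpow h2, zero_pow hj.ne']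
    · rw [← cpow_natCast, ← cpow_add _ _ (ofReal_ne_zero.2 h.ne')]
  rw [intervalIntegral.integral_congr heq, integral_cpow (Or.inl hr)]
  have hs0 : s - 1 + j + 1 = s + j := by ring
  rw [hs0, ofReal_one, ofReal_zero, Complex.one_cpow, Complex.zero_cpow hne, sub_zero]

/-- The Mellin integrand `t^{s-1} w(t)` vanishes for `t > 1` and equals `t^{s-1} P(t)/720` on
`(0, 1]`. [folklore] -/
private theorem mellin_integrand_eq (s : ℂ) (t : ℝ) :
    (t : ℂ) ^ (s - 1) • hoffWeight t =
      if t ≤ 1 then (t : ℂ) ^ (s - 1) * ((hoffPoly t / 720 : ℝ) : ℂ) else 0 := by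
  split_ifs with h
  · rw [smul_eq_mul, hoffWeight_of_le_one h]
  · rw [smul_eq_mul, hoffWeight_of_one_lt (not_le.1 h), mul_zero]

/-- Integrability of `t^{s-1} P(t)/720` on `(0, 1]` for `Re s > 0`. [folklore] -/
private theorem intervalIntegrable_cpow_mul_poly {s : ℂ} (hs : 0 < s.re) :
    IntervalIntegrable (fun t : ℝ ↦ (t : ℂ) ^ (s - 1) * ((hoffPoly t / 720 : ℝ) : ℂ)) volume 0 1 := by
  have h1 : IntervalIntegrable (fun t : ℝ ↦ (t : ℂ) ^ (s - 1)) volume 0 1 :=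
    intervalIntegral.intervalIntegrable_cpow' (by simp; linarith)
  refine h1.mul_continuousOn ?_
  refine (continuous_ofReal.comp ?_).continuousOn
  unfold hoffPoly; fun_prop

/-- **Mellin convergence** of the weight on `Re s > 0`. [cite: Hoffstein1980SiegelTatuzawa, §2 proof of Lemma 1 p. 168] -/
theorem mellinConvergent_hoffWeight {s : ℂ} (hs : 0 < s.re) : MellinConvergent hoffWeight s := by
  unfold MellinConvergent
  have hsplit : Ioi (0:ℝ) = Ioc 0 1 ∪ Ioi 1 := (Ioc_union_Ioi_eq_Ioi zero_le_one).symm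
  rw [hsplit]
  refine IntegrableOn.union ?_ ?_
  · have h := (intervalIntegrable_cpow_mul_poly hs).1
    refine (h.congr_fun (fun t ht ↦ ?_) measurableSet_Ioc)
    rw [mellin_integrand_eq, if_pos ht.2]
  · refine (integrableOn_zero (s := Ioi (1:ℝ))).congr_fun (fun t ht ↦ ?_) measurableSet_Ioi
    rw [mellin_integrand_eq, if_neg (not_le.2 ht)]

/-- The coefficients of `P`: `P(u) = Σ_{j<7} c_j u^j` with `c = (1, 0, −15, 40, −45, 24, −5)`.
[folklore] -/
private def hoffCoef : Fin 7 → ℂ := ![1, 0, -15, 40, -45, 24, -5]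

/-- `P(t)/720 = Σ_j c_j t^j/720`. [folklore] -/
private theorem hoffPoly_eq_sum (t : ℝ) :
    ((hoffPoly t / 720 : ℝ) : ℂ) = ∑ j : Fin 7, hoffCoef j / 720 * (t : ℂ) ^ (j : ℕ) := by
  rw [Fin.sum_univ_seven]
  simp [hoffCoef, hoffPoly]
  ring

/-- `K(s) = Σ_j (c_j/720)/(s+j)`. [folklore] -/
private theorem hoffKernel_eq_sum {s : ℂ} (hs : 0 < s.re) :
    hoffKernel s = ∑ j : Fin 7, hoffCoef j / 720 * (1 / (s + (j : ℕ))) := by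
  have hne : ∀ j : ℕ, s + j ≠ 0 := fun j h' ↦ by
    have := congrArg Complex.re h'; simp at this; linarith [(j.cast_nonneg : (0:ℝ) ≤ j)]
  rw [hoffKernel_eq_partialFractions (by simpa using hne 0) (hne 2) (hne 3) (hne 4) (hne 5) (hne 6),
    Fin.sum_univ_seven]
  simp [hoffCoef]
  ring

/-- **The Mellin transform of Hoffstein's weight is his kernel**: for `Re s > 0`,
`∫₀^∞ w(t) t^{s-1} dt = (1/720) ∫₀¹ P(t) t^{s-1} dt = K(s)`.
[cite: Hoffstein1980SiegelTatuzawa, §2 p. 168 ("the standard argument")] -/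
theorem mellin_hoffWeight {s : ℂ} (hs : 0 < s.re) : mellin hoffWeight s = hoffKernel s := by
  -- reduce to `(0, 1]`
  have hIoi : mellin hoffWeight s =
      ∫ t in Ioc (0:ℝ) 1, (t : ℂ) ^ (s - 1) * ((hoffPoly t / 720 : ℝ) : ℂ) := by
    unfold mellin
    rw [setIntegral_eq_of_subset_of_forall_sdiff_eq_zero measurableSet_Ioi Ioc_subset_Ioi_self
      (fun t ht ↦ ?_)]
    · refine setIntegral_congr_fun measurableSet_Ioc fun t ht ↦ ?_
      rw [mellin_integrand_eq, if_pos ht.2]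
    · have ht1 : 1 < t := by
        rcases ht with ⟨h1, h2⟩
        by_contra h; exact h2 ⟨h1, not_lt.1 h⟩
      rw [mellin_integrand_eq, if_neg (not_le.2 ht1)]
  rw [hIoi, ← intervalIntegral.integral_of_le zero_le_one]
  -- expand the polynomial and integrate termwise
  set g : Fin 7 → ℝ → ℂ := fun j t ↦ hoffCoef j / 720 * ((t : ℂ) ^ (s - 1) * (t : ℂ) ^ (j : ℕ))
    with hg
  have hexp : ∀ t : ℝ, (t : ℂ) ^ (s - 1) * ((hoffPoly t / 720 : ℝ) : ℂ) = ∑ j : Fin 7, g j t := by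
    intro t
    rw [hoffPoly_eq_sum, Finset.mul_sum]
    refine Finset.sum_congr rfl fun j _ ↦ ?_
    rw [hg]; ring
  have hI : ∀ j : Fin 7, IntervalIntegrable (g j) volume 0 1 := by
    intro j
    have h1 : IntervalIntegrable (fun t : ℝ ↦ (t : ℂ) ^ (s - 1)) volume 0 1 :=
      intervalIntegral.intervalIntegrable_cpow' (by simp; linarith)
    exact (h1.mul_continuousOn (by fun_prop)).const_mul _
  rw [intervalIntegral.integral_congr (fun t _ ↦ hexp t),
    intervalIntegral.integral_finsetSum (fun j _ ↦ hI j), hoffKernel_eq_sum hs]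
  refine Finset.sum_congr rfl fun j _ ↦ ?_
  rw [hg]
  simp only
  rw [intervalIntegral.integral_const_mul, integral_cpow_mul_pow hs]

/-! ### The kernel on vertical lines -/

/-- `‖σ + j + iy‖ ≥ ‖σ + iy‖` for `σ > 0`, `j ≥ 0`. [folklore] -/
private theorem norm_add_nat_ge {c : ℝ} (hc : 0 < c) (y : ℝ) (j : ℕ) :
    ‖(c : ℂ) + y * I‖ ≤ ‖(c : ℂ) + y * I + j‖ := by
  have h1 : ‖(c : ℂ) + y * I‖ ^ 2 = c ^ 2 + y ^ 2 := by
    rw [Complex.sq_norm, Complex.normSq_apply]; simp; ring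
  have h2 : ‖(c : ℂ) + y * I + j‖ ^ 2 = (c + j) ^ 2 + y ^ 2 := by
    rw [Complex.sq_norm, Complex.normSq_apply]; simp; ring
  have hj : (0:ℝ) ≤ j := j.cast_nonneg
  have : ‖(c : ℂ) + y * I‖ ^ 2 ≤ ‖(c : ℂ) + y * I + j‖ ^ 2 := by rw [h1, h2]; nlinarith
  exact (pow_le_pow_iff_left₀ (norm_nonneg _) (norm_nonneg _) two_ne_zero).1 this

/-- On a line `Re s = c > 0`: `‖K(c + iy)‖ ≤ 1/(c⁴ (c² + y²))` (absolute convergence of Hoffstein's integral on `Re s = 2`). [cite: Hoffstein1980SiegelTatuzawa, §2 proof of Lemma 1 p. 168] -/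
theorem norm_hoffKernel_le_of_pos {c : ℝ} (hc : 0 < c) (y : ℝ) :
    ‖hoffKernel (c + y * I)‖ ≤ 1 / (c ^ 4 * (c ^ 2 + y ^ 2)) := by
  set w : ℂ := (c : ℂ) + y * I with hw
  have hw2 : ‖w‖ ^ 2 = c ^ 2 + y ^ 2 := by
    rw [hw, Complex.sq_norm, Complex.normSq_apply]; simp; ring
  have hcw : c ≤ ‖w‖ := by
    have : c ^ 2 ≤ ‖w‖ ^ 2 := by rw [hw2]; nlinarith
    exact (pow_le_pow_iff_left₀ hc.le (norm_nonneg _) two_ne_zero).1 this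
  have hwpos : 0 < ‖w‖ := hc.trans_le hcw
  have hge : ∀ j : ℕ, ‖w‖ ≤ ‖w + j‖ := fun j ↦ norm_add_nat_ge hc y j
  unfold hoffKernel
  rw [norm_div, norm_one]
  simp only [norm_mul]
  have e2 : ‖w + 2‖ ≥ c := hcw.trans (by simpa using hge 2)
  have e3 : ‖w + 3‖ ≥ c := hcw.trans (by simpa using hge 3)
  have e4 : ‖w + 4‖ ≥ c := hcw.trans (by simpa using hge 4)
  have e5 : ‖w + 5‖ ≥ c := hcw.trans (by simpa using hge 5)
  have e6 : ‖w + 6‖ ≥ ‖w‖ := by simpa using hge 6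
  have hden : c ^ 4 * (c ^ 2 + y ^ 2) ≤ ‖w‖ * ‖w + 2‖ * ‖w + 3‖ * ‖w + 4‖ * ‖w + 5‖ * ‖w + 6‖ := by
    rw [← hw2]
    have h4 : c ^ 4 ≤ ‖w + 2‖ * ‖w + 3‖ * ‖w + 4‖ * ‖w + 5‖ := by
      calc c ^ 4 = c * c * c * c := by ring
        _ ≤ ‖w + 2‖ * ‖w + 3‖ * ‖w + 4‖ * ‖w + 5‖ := by
          gcongr
    calc c ^ 4 * ‖w‖ ^ 2 = ‖w‖ * c ^ 4 * ‖w‖ := by ring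
      _ ≤ ‖w‖ * (‖w + 2‖ * ‖w + 3‖ * ‖w + 4‖ * ‖w + 5‖) * ‖w + 6‖ := by gcongr
      _ = _ := by ring
  have hpos : 0 < c ^ 4 * (c ^ 2 + y ^ 2) := by positivity
  exact one_div_le_one_div_of_le hpos hden

/-- The kernel is absolutely integrable along every line `Re s = c > 0`. [cite: Hoffstein1980SiegelTatuzawa, §2 proof of Lemma 1 p. 168] -/
theorem integrable_hoffKernel_vertical {c : ℝ} (hc : 0 < c) :
    Integrable fun y : ℝ ↦ hoffKernel (c + y * I) := by
  have hcont : Continuous fun y : ℝ ↦ hoffKernel (c + y * I) := by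
    unfold hoffKernel
    have hne : ∀ (y : ℝ) (j : ℝ), 0 ≤ j → (c : ℂ) + y * I + j ≠ 0 := by
      intro y j hj h
      have := congrArg Complex.re h; simp at this; linarith
    refine continuous_const.div (by fun_prop) fun y ↦ ?_
    have h0 := hne y 0 le_rfl
    have h2 := hne y 2 (by norm_num); have h3 := hne y 3 (by norm_num)
    have h4 := hne y 4 (by norm_num); have h5 := hne y 5 (by norm_num)
    have h6 := hne y 6 (by norm_num)
    simp only [ofReal_zero, add_zero] at h0
    push_cast at h2 h3 h4 h5 h6
    exact mul_ne_zero (mul_ne_zero (mul_ne_zero (mul_ne_zero (mul_ne_zero h0 h2) h3) h4) h5) h6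
  have hmaj : Integrable fun y : ℝ ↦ 1 / (c ^ 4 * (c ^ 2 + y ^ 2)) := by
    have h := (integrable_inv_one_add_sq).comp_div hc.ne'
    have h' : Integrable fun y : ℝ ↦ (1 / c ^ 6) * (1 + (y / c) ^ 2)⁻¹ := h.const_mul _
    refine h'.congr (Eventually.of_forall fun y ↦ ?_)
    simp only
    have hc0 : c ≠ 0 := hc.ne'
    field_simp
  refine hmaj.mono' hcont.aestronglyMeasurable (Eventually.of_forall fun y ↦ ?_)
  exact norm_hoffKernel_le_of_pos hc y

/-! ### The smoothed Perron formula -/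

/-- `‖x^{c+iy}‖ = x^c` for `x > 0`. [folklore] -/
private theorem norm_ofReal_cpow_line {x : ℝ} (hx : 0 < x) (c y : ℝ) :
    ‖(x : ℂ) ^ ((c : ℂ) + y * I)‖ = x ^ c := by
  rw [norm_cpow_eq_rpow_re_of_pos hx]; simp

/-- Shifting the variable: `term a (s + w) n · x^w = term a s n · (x/n)^w` (`x ≥ 0`). [folklore] -/
private theorem term_add_mul_cpow (a : ℕ → ℂ) {x : ℝ} (hx : 0 ≤ x) (s w : ℂ) (n : ℕ) :
    LSeries.term a (s + w) n * (x : ℂ) ^ w = LSeries.term a s n * (((x / n : ℝ)) : ℂ) ^ w := by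
  rcases eq_or_ne n 0 with rfl | hn
  · simp
  have hn0 : (0 : ℝ) < n := by exact_mod_cast Nat.pos_of_ne_zero hn
  have hnc : (n : ℂ) ≠ 0 := by exact_mod_cast hn
  have hdiv : (((x / n : ℝ)) : ℂ) ^ w = (x : ℂ) ^ w / (n : ℂ) ^ w := by
    rw [div_eq_mul_inv, ofReal_mul, mul_cpow_ofReal_nonneg hx (inv_nonneg.2 hn0.le), ofReal_inv,
      ofReal_natCast, inv_cpow _ _ (by rw [natCast_arg]; exact Real.pi_ne_zero.symm), div_eq_mul_inv]
  rw [LSeries.term_of_ne_zero hn, LSeries.term_of_ne_zero hn, hdiv, cpow_add _ _ hnc]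
  field_simp

/-- `(p)^{-w} = (1/p)^{w}` for `p > 0`. [folklore] -/
private theorem ofReal_cpow_neg_eq_inv_cpow {p : ℝ} (hp : 0 < p) (w : ℂ) :
    (p : ℂ) ^ (-w) = ((p⁻¹ : ℝ) : ℂ) ^ w := by
  rw [cpow_neg, ofReal_inv,
    inv_cpow _ _ (by rw [arg_ofReal_of_nonneg hp.le]; exact Real.pi_ne_zero.symm)]

/-- **The smoothed Perron formula for Hoffstein's kernel** (Hoffstein 1980, p. 169, the display
defining `I`, in Mellin form). Let `f(z) = Σ a(n) n^{-z}` be an `L`-series, `c > 0`, and suppose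
`Σ ‖a(n)‖ n^{-(Re s + c)} < ∞`. Then for `x > 0`,
`∫ f(s + c + iy) x^{c+iy} K(c+iy) dy = 2π Σ_n a(n) n^{-s} w(n/x)`, i.e.
`(1/2πi) ∫_{(c)} f(s+z) x^z K(z) dz = Σ_{n ≤ x} a(n) n^{-s} P(n/x)/720`: Mellin inversion for the
weight `w` (whose transform is `K`) at the points `n/x`, summed over `n` (the interchange being
justified by absolute convergence). [cite: Hoffstein1980SiegelTatuzawa, §2 p. 169] -/
theorem integral_LSeries_mul_hoffKernel_eq (a : ℕ → ℂ) {s : ℂ} {c : ℝ} (hc : 0 < c)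
    (ha : Summable fun n : ℕ ↦ ‖LSeries.term a (s + c) n‖) {x : ℝ} (hx : 0 < x) :
    ∫ y : ℝ, LSeries a (s + c + y * I) * (x : ℂ) ^ ((c : ℂ) + y * I) * hoffKernel (c + y * I) =
      2 * Real.pi * ∑' n : ℕ, LSeries.term a s n * hoffWeight ((n : ℝ) / x) := by
  set κ : ℂ → ℂ := hoffKernel with hκdef
  have hκi : Integrable fun y : ℝ ↦ κ (c + y * I) := integrable_hoffKernel_vertical hc
  set F : ℕ → ℝ → ℂ := fun n y ↦ LSeries.term a s n *
    ((((x / n : ℝ)) : ℂ) ^ ((c : ℂ) + y * I) * κ (c + y * I)) with hF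
  -- (1) Mellin inversion at the point `n / x`
  have hinv : ∀ n : ℕ, n ≠ 0 →
      ∫ y : ℝ, (((x / n : ℝ)) : ℂ) ^ ((c : ℂ) + y * I) * κ (c + y * I) =
        2 * Real.pi * hoffWeight ((n : ℝ) / x) := by
    intro n hn
    have hn0 : (0 : ℝ) < n := by exact_mod_cast Nat.pos_of_ne_zero hn
    have hu : 0 < (n : ℝ) / x := div_pos hn0 hx
    have hκ : ∀ y : ℝ, mellin hoffWeight (c + y * I) = κ (c + y * I) := fun y ↦
      mellin_hoffWeight (by simp [hc])
    have hVI : VerticalIntegrable (mellin hoffWeight) c :=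
      hκi.congr (Eventually.of_forall fun y ↦ (hκ y).symm)
    have key := mellinInv_mellin_eq c hoffWeight hu (mellinConvergent_hoffWeight (by simp [hc])) hVI
      continuous_hoffWeight.continuousAt
    rw [mellinInv] at key
    have h2 : ∫ y : ℝ, ((((n : ℝ) / x : ℝ)) : ℂ) ^ (-((c : ℂ) + y * I)) • mellin hoffWeight (c + y * I) =
        ∫ y : ℝ, (((x / n : ℝ)) : ℂ) ^ ((c : ℂ) + y * I) * κ (c + y * I) := by
      refine integral_congr_ae (Eventually.of_forall fun y ↦ ?_)
      simp only [smul_eq_mul]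
      rw [hκ y, ofReal_cpow_neg_eq_inv_cpow hu, inv_div]
    rw [h2, Complex.real_smul] at key
    have hπ : (2 * Real.pi : ℂ) * ((1 / (2 * Real.pi) : ℝ) : ℂ) = 1 := by
      push_cast
      field_simp
    rw [← key, ← mul_assoc, hπ, one_mul]
  -- (2) the integrals of the terms
  have hFint : ∀ n, ∫ y, F n y = 2 * Real.pi * (LSeries.term a s n * hoffWeight ((n : ℝ) / x)) := by
    intro n
    rcases eq_or_ne n 0 with rfl | hn
    · simp [hF]
    · simp only [hF]
      rw [MeasureTheory.integral_const_mul, hinv n hn]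
      ring
  -- (3) integrability of the terms and summability of their `L¹` norms
  have hcont : ∀ n : ℕ, n ≠ 0 → Continuous fun y : ℝ ↦ (((x / n : ℝ)) : ℂ) ^ ((c : ℂ) + y * I) := by
    intro n hn
    have hn0 : (0 : ℝ) < n := by exact_mod_cast Nat.pos_of_ne_zero hn
    have hy0 : 0 < x / n := div_pos hx hn0
    have h0 : (((x / n : ℝ)) : ℂ) ≠ 0 := ofReal_ne_zero.2 hy0.ne'
    exact (by fun_prop : Continuous fun y : ℝ ↦ (c : ℂ) + y * I).const_cpow (Or.inl h0)
  have hFi : ∀ n, Integrable (F n) := by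
    intro n
    rcases eq_or_ne n 0 with rfl | hn
    · simp only [hF, LSeries.term_zero, zero_mul]; exact integrable_zero _ _ _
    have hn0 : (0 : ℝ) < n := by exact_mod_cast Nat.pos_of_ne_zero hn
    have hy0 : 0 < x / n := div_pos hx hn0
    simp only [hF]
    simp_rw [← mul_assoc]
    refine hκi.bdd_mul ((continuous_const.mul (hcont n hn)).aestronglyMeasurable)
      (c := ‖LSeries.term a s n‖ * (x / n) ^ c) (Eventually.of_forall fun y ↦ ?_)
    rw [norm_mul, norm_ofReal_cpow_line hy0]
  have hnormF : ∀ n y, ‖F n y‖ = ‖LSeries.term a s n‖ * (x / n) ^ c * ‖κ (c + y * I)‖ := by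
    intro n y
    rcases eq_or_ne n 0 with rfl | hn
    · simp [hF]
    have hn0 : (0 : ℝ) < n := by exact_mod_cast Nat.pos_of_ne_zero hn
    simp only [hF, norm_mul, norm_ofReal_cpow_line (div_pos hx hn0)]
    ring
  -- `‖term a s n‖ (x/n)^c = x^c ‖term a (s+c) n‖`
  have hshift : ∀ n : ℕ, ‖LSeries.term a s n‖ * (x / n) ^ c = x ^ c * ‖LSeries.term a (s + c) n‖ := by
    intro n
    rcases eq_or_ne n 0 with rfl | hn
    · simp
    have hn0 : (0 : ℝ) < n := by exact_mod_cast Nat.pos_of_ne_zero hn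
    rw [LSeries.term_of_ne_zero hn, LSeries.term_of_ne_zero hn, norm_div, norm_div,
      norm_natCast_cpow_of_pos (Nat.pos_of_ne_zero hn), norm_natCast_cpow_of_pos (Nat.pos_of_ne_zero hn),
      Real.div_rpow hx.le hn0.le, add_re, ofReal_re, Real.rpow_add hn0]
    field_simp
  have hFsum : Summable fun n ↦ ∫ y, ‖F n y‖ := by
    have hval : ∀ n, ∫ y, ‖F n y‖ = ‖LSeries.term a s n‖ * (x / n) ^ c * ∫ y : ℝ, ‖κ (c + y * I)‖ := by
      intro n
      simp_rw [hnormF n]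
      exact MeasureTheory.integral_const_mul (μ := volume) (‖LSeries.term a s n‖ * (x / n) ^ c)
        (fun y : ℝ ↦ ‖κ (c + y * I)‖)
    simp_rw [hval, hshift]
    set Iκ : ℝ := ∫ y : ℝ, ‖κ (c + y * I)‖ with hIκ
    have : Summable fun n : ℕ ↦ (x ^ c * Iκ) * ‖LSeries.term a (s + c) n‖ := ha.mul_left _
    refine this.congr fun n ↦ ?_
    ring
  -- (4) the pointwise sum `Σ_n F n y = f(s+c+iy) x^{c+iy} κ(c+iy)`
  have hsumF : ∀ y : ℝ, HasSum (fun n ↦ F n y)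
      (LSeries a (s + c + y * I) * (x : ℂ) ^ ((c : ℂ) + y * I) * κ (c + y * I)) := by
    intro y
    have hsm : LSeriesSummable a (s + c + y * I) := by
      have h1 : LSeriesSummable a (s + c) := .of_norm ha
      exact (LSeriesSummable_iff_of_re_eq_re (by simp)).1 h1
    have hL := hsm.hasSum
    have := hL.mul_right ((x : ℂ) ^ ((c : ℂ) + y * I) * κ (c + y * I))
    simp only [hF, ← mul_assoc] at this ⊢
    refine this.congr_fun fun n ↦ ?_
    rw [show s + (c : ℂ) + y * I = s + ((c : ℂ) + y * I) by ring, term_add_mul_cpow a hx.le]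
  -- (5) conclusion
  calc ∫ y : ℝ, LSeries a (s + c + y * I) * (x : ℂ) ^ ((c : ℂ) + y * I) * κ (c + y * I)
      = ∫ y : ℝ, ∑' n : ℕ, F n y :=
        integral_congr_ae (Eventually.of_forall fun y ↦ ((hsumF y).tsum_eq).symm)
    _ = ∑' n : ℕ, ∫ y, F n y := (integral_tsum_of_summable_integral_norm hFi hFsum).symm
    _ = ∑' n : ℕ, 2 * Real.pi * (LSeries.term a s n * hoffWeight ((n : ℝ) / x)) := tsum_congr hFint
    _ = _ := tsum_mul_left

/-- The smoothed sum is a finite sum over `n ≤ x` ("the right-hand sum goes over all ideals … with norm `≤ x`"). [cite: Hoffstein1980SiegelTatuzawa, §2 proof of Lemma 1 p. 169] -/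
theorem tsum_term_mul_hoffWeight_eq_sum (a : ℕ → ℂ) (s : ℂ) {x : ℝ} (hx : 0 < x) (N : ℕ)
    (hN : x < N + 1) :
    ∑' n : ℕ, LSeries.term a s n * hoffWeight ((n : ℝ) / x) =
      ∑ n ∈ Finset.range (N + 1), LSeries.term a s n * hoffWeight ((n : ℝ) / x) := by
  refine tsum_eq_sum fun n hn ↦ ?_
  rw [Finset.mem_range, not_lt] at hn
  have hn' : x < n := hN.trans_le (by exact_mod_cast hn)
  rw [hoffWeight_of_one_lt (by rwa [lt_div_iff₀ hx, one_mul]), mul_zero]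

end Literature.NumberTheory.LFunctions.Hoffstein1980

end
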